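import Summits.BirchSwinnertonDyer.Rank1Residual.Partition.MainConjectures
import Literature.NumberTheory.EllipticCurves.GreenbergVatsal2000.CongruentCurves
import Literature.NumberTheory.EllipticCurves.Rank1Residual.X10MainConjecture
import Literature.NumberTheory.EllipticCurves.SkinnerUrban2014.PAdicUnitPeriodRatioProofs
import Literature.NumberTheory.EllipticCurves.NonEisensteinPrimeOfSurjective
import Literature.NumberTheory.EllipticCurves.EmertonPollackWeston2006.MuAnTransferGoodOrdinary
import HarnessLib

/-!
# Row C16 / class X10a′ at `p = 3` WITHOUT Beilinson–Flach: Mazur's main conjecture and `BSD(E,3)`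
# by CONGRUENCE TRANSFER (Greenberg–Vatsal 2000, Thm. (1.4)) from a mod-`3`-congruent partner curve
# whose main conjecture is a theorem of the published record
# (cell `bsd-litref`, paper sub-dir `yz26`, seat `bsd-litref-yz26-pv`; LADDER-BSD H0/H1 · W7, row D3)

HONEST FRAMING (programme `BSD-LIT2PART-PROGRAMME-v1.md` §HONESTY, verbatim): «no tranche here
proves BSD; ARM L moves the LITERAL column of an r ≤ 1 census into the
kernel-proved-modulo-named-print column; ARM P changes what «named print» is worth.» Theorems only:
no definition, no new named fact; every published theorem enters as one of the tree's EXISTING named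
facts, taken as a hypothesis. Nothing here changes a label; this is a PER-PAIR CERTIFICATE road
(construction-shaped inputs: a partner curve, a torsion isomorphism, a `μ`-certificate), the
irreducible twin of the cell's route G for class X2 (`X2/CongruenceTransferCovered.lean`) and of route
U1′ for class X9 (`GreenbergVatsal2000/CongruentCurves.lean`, CM partner).

## Why (row D3 of the partition scoreboard = row C16 at `p = 3`, 4 814 classes LITERAL)

Row C16 (`p = 3` good ordinary, `E[3]` irreducible, (Im)) is closed as a CLASS only by Yan–Zhu,
J. Algebra 693 (2026) Thm. 5.11 (`YanZhu2026.thm415_…`), whose printed proof at `p = 3` runs through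
the two-variable Beilinson–Flach equivalence; referee C ROUND 361 (2026-08-26) CONFIRMED the flag
`YZ26@3-BF-ERL-Ohta` as GAP(BSTW p0029:L7) with two prongs (Λ-adic Eichler–Shimura at `3` on `ω⁰` for
`f_E`'s Hida family and on `ω⁻¹` for the CM family) — no printed source; the row stays literal. The
x10 cell recorded (`Rank1Residual/X10MainConjecture.lean`) that on the rank-`0` branch the flag bites on
EXACTLY ONE statement, Mazur's cyclotomic main conjecture at `(E,3)`, and that this main conjecture is
a theorem of the published record at every curve where a PER-CURVE lever closes `BSD(E,3)` (Wuthrich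
2014 Prop. 21 with `3 ∤ #Ш_an`, or Prop. 21 + Cassels–Tate + a `3`-descent). THIS FILE adds the lever
for the curves those two miss (`9 ∣ #Ш_an` without a descent certificate, `81 ∣ #Ш_an`, …): IMPORT the
main conjecture from a CONGRUENT curve.

## The road (all inputs PUBLISHED and already typed; `p = 3` is inside every printed range)

Let `E₂/ℚ` be the target (good ordinary at `3`) and `E₁/ℚ` a PARTNER with `E₁[3] ≅ E₂[3]` as
`Γ_ℚ`-modules (certificate C1), `E₁` good ordinary at `3` with `ρ̄_{E₁,3}` surjective, `L(E₁,1) ≠ 0`,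
and `BSD(E₁,3)` KNOWN (any flag-free road: lever L1 `3 ∤ #Ш_an(E₁)` — Wuthrich, Doc. Math. 19 (2014)
Prop. 21, named fact `Wuthrich2014.sha_dvd_analyticSha`; or the Cassels–Tate lever; or anything else
the lane certifies). Then:
1. `ρ_{E₁,3^∞}` is surjective (Wuthrich 2014 Lemma 20, `lemma20_surjective_threeAdic_of_semistable`),
   so Kato, Astérisque 295 (2004) Thm. 17.4 (3) (`kato_divisibility`, integral clause) applies, and
   with Greenberg LNM 1716 Thm. 4.1 (`greenberg_charValue_rankZero`) and the period unit at an
   irreducible good odd prime (Mazur 1978 Cor. 4.1, `mazur_not_dvd_maninConstant_of_odd`, through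
   `SkinnerUrban2014.periodUnit_of_mazur`) the x10 cell's `mainConjecture_of_bsdp_of_kato` turns
   `BSD(E₁,3)` into MAZUR'S MAIN CONJECTURE FOR `(E₁,3)` in the Néron normalisation
   (`MazurMainConjecture E₁ 3`, the tree's `@[conjecture]` predicate — here a theorem for this curve).
2. Certificate C2 — ONE exact coefficient of `𝓛_MSD(E₁) = ϖ₁ · L_3(f₁, α₁)` is a `3`-adic unit — is
   `μ(E₁) = 0` (`GreenbergVatsal2000.hasUnitContent_iff_exists_norm_coeff_map_eq_one`).
3. Greenberg–Vatsal, Invent. Math. 142 (2000) Thm. (1.4) ("Let `p` be an odd prime …", named fact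
   `GreenbergVatsal2000.thm14_mainConjecture_transfer_of_torsionIso`) moves the main conjecture with
   `μ = 0` along C1 to `E₂`: `MazurMainConjecture E₂ 3` (`mazurMainConjecture_three_of_congruentPartner`).
4. Rank `0`: `RowC16.bsdp_rankZero_of_mazurMainConjecture` (Castella–Grossi–Lee–Skinner's descent,
   image-free) gives `BSD(E₂,3)` — `RowC16.bsdp_three_rankZero_of_congruentPartner`; no hypothesis on
   `#Ш_an(E₂)`, no (ram) prime, no Beilinson–Flach class. Rank `1`: the cyclotomic skeleton
   `RowC16.bsdp_rankOne_of_mazurMainConjecture_of_schneider` (modulo the Schneider certificate) —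
   `RowC16.bsdp_three_rankOne_of_congruentPartner_of_schneider`.
Where partners live: every `E₁` in the mod-`3` congruence class of `E₂` (the genus-`0` twist families
`X_{E₂}(3)`, `X⁻_{E₂}(3)`; in practice Cremona's table) with `r_an(E₁) = 0` and `3 ∤ #Ш_an(E₁)`
qualifies for the L1 form below; the cell census `pub/bsd-litref/yz26/D3-DOOR-CENSUS.md` sizes this.

## What is NOT claimed

No class is closed by this file: C1 (torsion isomorphism), C2 (`μ`-coefficient) and the partner's
`#Ш_an` are per-pair CERTIFICATES, explicit binders of every theorem below, to be produced by the
lane's engines and priced by the referee; the named facts are hypotheses (`kato_divisibility` for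
`E₁`, `greenberg_charValue_rankZero`, `nonempty_modularParametrizationData`, GZK, Wuthrich Prop. 21 /
Lemma 20, Mazur 1978 Cor. 4.1, Greenberg–Vatsal (1.4)). Nothing is asserted about Yan–Zhu's theorem.

References: [GreenbergVatsal2000] Thm. (1.4) (Invent. Math. 142 (2000) §1; arXiv:math/9906215 p. 5);
[Kato2004Asterisque] Thm. 17.4 (3) (p. 273); [GreenbergLNM1716] Thm. 4.1, §5; [Wuthrich2014] Lemma 20,
Prop. 21 (p. 400); [Mazur1978] Cor. 4.1; [CastellaEtAl2021] Thm. 5.1.4 (proof); [PerrinRiou1987] §1.4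
Cor. 1.8; [BalakrishnanMullerStein2015] Thm. 1.7; [YanZhu2024MainConjNonCM] Thm. 5.11 = v2 Thm. 4.15.
-/

set_option autoImplicit false

noncomputable section

open scoped Classical MatrixGroups ModularForm

open CongruenceSubgroup WeierstrassCurve Field Literature.NumberTheory.EllipticCurves
  Literature.NumberTheory.EllipticCurves.ModularForms
  Literature.NumberTheory.EllipticCurves.Rank1Residual
  Literature.NumberTheory.EllipticCurves.GreenbergVatsal2000
  Literature.NumberTheory.EllipticCurves.Wuthrich2014
  Literature.NumberTheory.EllipticCurves.EmertonPollackWeston2006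
  Summit.BirchSwinnertonDyer.BirchSwinnertonDyer.Theorems.Rank1ResidualX1Defs

namespace Summit.BirchSwinnertonDyer.Rank1Residual

section Partner

variable (W₁ W₂ : WeierstrassCurve ℚ) [W₁.IsElliptic] [W₁.IsGloballyMinimal]
  [W₂.IsElliptic] [W₂.IsGloballyMinimal]

/-! ### §1 The partner side: Mazur's main conjecture with `μ = 0` for `(E₁, 3)` -/

/-- **The `E₁`-hypothesis of Greenberg–Vatsal (1.4) from Mazur's main conjecture for `(E₁,p)` and
the `μ`-certificate.** If `MazurMainConjecture W₁ p` holds (Néron normalisation: `X` torsion and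
`char X = (g)` with `ι g = ϖ · L_p(f, α)` for every datum) and ONE coefficient of `ϖ · L_p(f, α)` is
a `p`-adic unit for every newform/period normalisation (certificate C2, `hμ`), then the generator has
unit content (`μ = 0`), i.e. the hypothesis of `thm14_mainConjecture_transfer_of_torsionIso` for `E₁`
holds. Bookkeeping (`hasUnitContent_iff_exists_norm_coeff_map_eq_one`), verbatim the proof of
`GreenbergVatsal2000.thm14Hypothesis_of_cm` with Rubin's theorem replaced by `hMC`.
[cite: GreenbergVatsal2000, Thm. (1.4) (arXiv:math/9906215 p. 5) and (2) (p. 2)] -/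
theorem thm14Hypothesis_of_mazurMainConjecture_of_unitCoeff (p : ℕ) [Fact p.Prime]
    (hMC : MazurMainConjecture W₁ p)
    (hμ : ∀ [NeZero (W₁.conductorNorm ℤ)] (f₁ : CuspForm (Gamma0 (W₁.conductorNorm ℤ)) 2),
        IsNewformOf W₁ f₁ → ∀ (ϖ₁ : ℚ), (ϖ₁ : ℝ) * W₁.realPeriodRat = plusPeriod f₁ →
      ∃ n : ℕ, ‖PowerSeries.coeff n
        (PowerSeries.C (ϖ₁ : ℚ_[p]) * padicLFunction f₁ (unitRoot W₁ p : ℚ_[p]))‖ = 1) :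
    ∀ (κ : ZpExtension ℚ p) (γ : Field.absoluteGaloisGroup ℚ),
        κ.IsCyclotomic → κ.IsTopGenerator γ → IsCyclotomicVariable p γ →
      ∀ [NeZero (W₁.conductorNorm ℤ)] (f₁ : CuspForm (Gamma0 (W₁.conductorNorm ℤ)) 2),
        IsNewformOf W₁ f₁ → ∀ (ϖ₁ : ℚ), (ϖ₁ : ℝ) * W₁.realPeriodRat = plusPeriod f₁ →
      ∀ (D₁ : W₁.SelmerDualData κ γ), D₁.IsTorsion ∧
        ∃ g₁ : IwasawaAlgebra p, D₁.charIdeal = Ideal.span {g₁} ∧ HasUnitContent g₁ ∧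
          iwasawaToPowerSeries p g₁ =
            PowerSeries.C (ϖ₁ : ℚ_[p]) * padicLFunction f₁ (unitRoot W₁ p : ℚ_[p]) := by
  intro κ γ hκ hγ hγ' _ f₁ hf₁ ϖ₁ hϖ₁ D₁
  obtain ⟨htors, g₁, hchar, hg⟩ := hMC κ γ hκ hγ hγ' f₁ hf₁ ϖ₁ hϖ₁ D₁
  refine ⟨htors, g₁, hchar, ?_, hg⟩
  rw [hasUnitContent_iff_exists_norm_coeff_map_eq_one, hg]
  exact hμ f₁ hf₁ ϖ₁ hϖ₁

/-- **Mazur's main conjecture for a rank-`0` partner `(E₁, 3)` from ITS `BSD(E₁,3)`** (the x10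
cell's `mainConjecture_of_bsdp_of_kato`, assembled with its side inputs): `E₁` good ordinary at `3`
with `ρ̄_{E₁,3}` surjective — hence `ρ_{E₁,3^∞}` surjective (Wuthrich 2014 Lemma 20, `hW20`) and
`E₁[3]` irreducible, so the period ratio `ϖ₁ = Ω⁺_{f₁}/Ω_{E₁}` is a `3`-adic unit (Mazur 1978 Cor. 4.1,
`hM`, via `SkinnerUrban2014.periodUnit_of_mazur`) —, `L(E₁,1) ≠ 0`, Kato Thm. 17.4 (3) for `E₁`
(`hK₁`), Greenberg Thm. 4.1 (`hGr`), GZK (`hGZK`); and `BSD(E₁,3)` (`hbsd₁`, closed by ANY road).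
[cite: Kato2004Asterisque, Thm. 17.4 (3) (p. 273)] [cite: GreenbergLNM1716, Thm. 4.1 and §5]
[cite: Wuthrich2014, Lemma 20 (p. 400)] [cite: Mazur1978, Cor. 4.1] -/
theorem mazurMainConjecture_three_of_bsdp_of_surj (hGr : greenberg_charValue_rankZero)
    (hGZK : rank_eq_analyticRank_of_analyticRank_le_one)
    (hW20 : lemma20_surjective_threeAdic_of_semistable) (hM : mazur_not_dvd_maninConstant_of_odd)
    (hK₁ : ∀ (κ : ZpExtension ℚ 3) (γ : Field.absoluteGaloisGroup ℚ) [NeZero (W₁.conductorNorm ℤ)]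
      (f : CuspForm (Gamma0 (W₁.conductorNorm ℤ)) 2), kato_divisibility W₁ 3 (κ := κ) (γ := γ) (f := f))
    (hord₁ : GoodOrd W₁ 3) (hsurj₁ : Surj W₁ 3) (hL₁ : W₁.entireLFunction 1 ≠ 0)
    (hbsd₁ : BSDp W₁ 3) : MazurMainConjecture W₁ 3 := by
  have hirr₁ : W₁.HasIrreducibleModPGaloisRep 3 :=
    hasIrreducibleModPGaloisRep_of_hasSurjectiveModNGaloisRep W₁ 3 hsurj₁
  have htower₁ : ∀ n : ℕ, W₁.HasSurjectiveModNGaloisRep (3 ^ n : ℕ) := hW20 W₁ (Or.inl hord₁.1) hsurj₁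
  have hϖ₁ : ∀ [NeZero (W₁.conductorNorm ℤ)] (f : CuspForm (Gamma0 (W₁.conductorNorm ℤ)) 2),
      IsNewformOf W₁ f → ∀ ϖ : ℚ, (ϖ : ℝ) * W₁.realPeriodRat = plusPeriod f → padicValRat 3 ϖ = 0 :=
    fun f hf ϖ hϖ => SkinnerUrban2014.periodUnit_of_mazur hM W₁ 3 (by decide) hord₁.1 hirr₁ f hf ϖ hϖ
  exact mainConjecture_of_bsdp_of_kato W₁ 3 hGr hGZK hK₁ (by decide) hord₁.1 hord₁.2 htower₁ hL₁ hϖ₁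
    hbsd₁

/-! ### §2 The transfer: Mazur's main conjecture for `(E₂, 3)` -/

/-- **Mazur's main conjecture for `(E₂, 3)` by congruence transfer from a rank-`0` partner** — the
HEADLINE of this file. Inputs BY NAME (all PUBLISHED, `p = 3` inside every printed range): Greenberg–
Vatsal 2000 Thm. (1.4) (`hGV`), Kato 2004 Thm. 17.4 (3) for the partner (`hK₁`), Greenberg LNM 1716
Thm. 4.1 (`hGr`), Gross–Zagier–Kolyvagin (`hGZK`), Wuthrich 2014 Lemma 20 (`hW20`), Mazur 1978 Cor.
4.1 (`hM`). PARTNER `E₁` (`W₁` globally minimal): good ordinary at `3`, `ρ̄_{E₁,3}` surjective,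
`L(E₁,1) ≠ 0`, `BSD(E₁,3)` known (`hbsd₁`), and certificate C2 (`hμ₁`: one `3`-adic unit
coefficient of `ϖ₁·L_3(f₁,α₁)`). TARGET `E₂`: good ordinary at `3`. CONGRUENCE certificate C1
(`hiso`): a `Γ_ℚ`-equivariant isomorphism `E₁[3] ≃ E₂[3]`. Conclusion: `MazurMainConjecture W₂ 3`.
Proof: §1 gives Greenberg–Vatsal's `E₁`-hypothesis; `GreenbergVatsal2000.mazurMainConjecture_of_thm14`
is (1.4) with (1.2) projected onto Mazur's statement.
[cite: GreenbergVatsal2000, Thm. (1.4) (arXiv:math/9906215 p. 5)] [cite: Kato2004Asterisque, Thm. 17.4 (3) (p. 273)]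
[cite: Wuthrich2014, Lemma 20 (p. 400)] [cite: Mazur1978, Cor. 4.1] -/
theorem mazurMainConjecture_three_of_congruentPartner
    (hGV : thm14_mainConjecture_transfer_of_torsionIso) (hGr : greenberg_charValue_rankZero)
    (hGZK : rank_eq_analyticRank_of_analyticRank_le_one)
    (hW20 : lemma20_surjective_threeAdic_of_semistable) (hM : mazur_not_dvd_maninConstant_of_odd)
    (hK₁ : ∀ (κ : ZpExtension ℚ 3) (γ : Field.absoluteGaloisGroup ℚ) [NeZero (W₁.conductorNorm ℤ)]
      (f : CuspForm (Gamma0 (W₁.conductorNorm ℤ)) 2), kato_divisibility W₁ 3 (κ := κ) (γ := γ) (f := f))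
    (hord₁ : GoodOrd W₁ 3) (hsurj₁ : Surj W₁ 3) (hL₁ : W₁.entireLFunction 1 ≠ 0) (hbsd₁ : BSDp W₁ 3)
    (hμ₁ : ∀ [NeZero (W₁.conductorNorm ℤ)] (f₁ : CuspForm (Gamma0 (W₁.conductorNorm ℤ)) 2),
        IsNewformOf W₁ f₁ → ∀ (ϖ₁ : ℚ), (ϖ₁ : ℝ) * W₁.realPeriodRat = plusPeriod f₁ →
      ∃ n : ℕ, ‖PowerSeries.coeff n
        (PowerSeries.C (ϖ₁ : ℚ_[3]) * padicLFunction f₁ (unitRoot W₁ 3 : ℚ_[3]))‖ = 1)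
    (hiso : ∃ e : geomTorsion W₁ ((3 : ℕ) : ℤ) ≃+ geomTorsion W₂ ((3 : ℕ) : ℤ),
      ∀ (σ : Field.absoluteGaloisGroup ℚ) (P : geomTorsion W₁ ((3 : ℕ) : ℤ)), e (σ • P) = σ • e P)
    (hord₂ : GoodOrd W₂ 3) : MazurMainConjecture W₂ 3 := by
  have hirr₁ : W₁.HasIrreducibleModPGaloisRep 3 :=
    hasIrreducibleModPGaloisRep_of_hasSurjectiveModNGaloisRep W₁ 3 hsurj₁
  have hMC₁ : MazurMainConjecture W₁ 3 :=
    mazurMainConjecture_three_of_bsdp_of_surj W₁ hGr hGZK hW20 hM hK₁ hord₁ hsurj₁ hL₁ hbsd₁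
  exact mazurMainConjecture_of_thm14 W₁ W₂ 3 hGV (by decide) hord₁.1 hord₁.2 hord₂.1 hord₂.2 hiso hirr₁
    (thm14Hypothesis_of_mazurMainConjecture_of_unitCoeff W₁ 3 hMC₁ hμ₁)

/-- **The `μ`-certificate may be computed on ANY member of the congruence class** (Emerton–Pollack–
Weston, Invent. Math. 163 (2006) Thm. 1, analytic half, at an odd prime: named fact
`EmertonPollackWeston2006.thm1_muAn_transfer_of_torsionIso_odd`, `hEPW`). Same as
`mazurMainConjecture_three_of_congruentPartner`, but certificate C2 is supplied for a WITNESS curve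
`E₃` (good ordinary at `3`; typically the member of smallest conductor, where one modular-symbol
coefficient is cheapest — e.g. the target `E₂` itself with `hiso₁₃ := hiso`) together with a
`Γ_ℚ`-equivariant `E₁[3] ≃ E₃[3]` (`hiso₁₃`); EPW moves `μ = 0` from `E₃` to the partner `E₁`.
[cite: EmertonPollackWeston2006, Thm. 1 (arXiv:math/0404484 p. 2), §1 Notation (p. 5)]
[cite: GreenbergVatsal2000, Thm. (1.4) (arXiv:math/9906215 p. 5)] -/
theorem mazurMainConjecture_three_of_congruentPartner_of_muWitness
    (hGV : thm14_mainConjecture_transfer_of_torsionIso) (hEPW : thm1_muAn_transfer_of_torsionIso_odd)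
    (hGr : greenberg_charValue_rankZero) (hGZK : rank_eq_analyticRank_of_analyticRank_le_one)
    (hW20 : lemma20_surjective_threeAdic_of_semistable) (hM : mazur_not_dvd_maninConstant_of_odd)
    (hK₁ : ∀ (κ : ZpExtension ℚ 3) (γ : Field.absoluteGaloisGroup ℚ) [NeZero (W₁.conductorNorm ℤ)]
      (f : CuspForm (Gamma0 (W₁.conductorNorm ℤ)) 2), kato_divisibility W₁ 3 (κ := κ) (γ := γ) (f := f))
    (hord₁ : GoodOrd W₁ 3) (hsurj₁ : Surj W₁ 3) (hL₁ : W₁.entireLFunction 1 ≠ 0) (hbsd₁ : BSDp W₁ 3)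
    (W₃ : WeierstrassCurve ℚ) [W₃.IsElliptic] [W₃.IsGloballyMinimal] (hord₃ : GoodOrd W₃ 3)
    (hiso₁₃ : ∃ e : geomTorsion W₁ ((3 : ℕ) : ℤ) ≃+ geomTorsion W₃ ((3 : ℕ) : ℤ),
      ∀ (σ : Field.absoluteGaloisGroup ℚ) (P : geomTorsion W₁ ((3 : ℕ) : ℤ)), e (σ • P) = σ • e P)
    (hμ₃ : ∀ [NeZero (W₃.conductorNorm ℤ)] (f₃ : CuspForm (Gamma0 (W₃.conductorNorm ℤ)) 2),
        IsNewformOf W₃ f₃ → ∀ (ϖ₃ : ℚ), (ϖ₃ : ℝ) * W₃.realPeriodRat = plusPeriod f₃ →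
      ∃ n : ℕ, ‖PowerSeries.coeff n
        (PowerSeries.C (ϖ₃ : ℚ_[3]) * padicLFunction f₃ (unitRoot W₃ 3 : ℚ_[3]))‖ = 1)
    (hiso : ∃ e : geomTorsion W₁ ((3 : ℕ) : ℤ) ≃+ geomTorsion W₂ ((3 : ℕ) : ℤ),
      ∀ (σ : Field.absoluteGaloisGroup ℚ) (P : geomTorsion W₁ ((3 : ℕ) : ℤ)), e (σ • P) = σ • e P)
    (hord₂ : GoodOrd W₂ 3) : MazurMainConjecture W₂ 3 := by
  have hirr₁ : W₁.HasIrreducibleModPGaloisRep 3 :=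
    hasIrreducibleModPGaloisRep_of_hasSurjectiveModNGaloisRep W₁ 3 hsurj₁
  have hμ₁ : ∀ [NeZero (W₁.conductorNorm ℤ)] (f₁ : CuspForm (Gamma0 (W₁.conductorNorm ℤ)) 2),
        IsNewformOf W₁ f₁ → ∀ (ϖ₁ : ℚ), (ϖ₁ : ℝ) * W₁.realPeriodRat = plusPeriod f₁ →
      ∃ n : ℕ, ‖PowerSeries.coeff n
        (PowerSeries.C (ϖ₁ : ℚ_[3]) * padicLFunction f₁ (unitRoot W₁ 3 : ℚ_[3]))‖ = 1 :=
    fun f₁ hf₁ ϖ₁ hϖ₁ => thm1_muAn_transfer_of_torsionIso_odd.symm hEPW W₁ W₃ 3 (by decide) hord₁.1 hord₁.2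
      hord₃.1 hord₃.2 hiso₁₃ hirr₁ hμ₃ f₁ hf₁ ϖ₁ hϖ₁
  exact mazurMainConjecture_three_of_congruentPartner W₁ W₂ hGV hGr hGZK hW20 hM hK₁ hord₁ hsurj₁ hL₁
    hbsd₁ hμ₁ hiso hord₂

/-! ### §3 `BSD(E₂, 3)` on row C16 -/

/-- **Row C16 ∩ {r = 0} at `p = 3` WITHOUT Beilinson–Flach: `BSD(E₂,3)` by congruence transfer from a
rank-`0` partner.** `MazurMainConjecture W₂ 3` from `mazurMainConjecture_three_of_congruentPartner`,
then the universal rank-`0` skeleton `RowC16.bsdp_rankZero_of_mazurMainConjecture` (modularity `hmod`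
with an integral Manin constant; Greenberg Thm. 4.1; GZK). No hypothesis on `#Ш_an(E₂)`, no (ram)
prime, no Yan–Zhu fact. Per pair (certificates C1, C2, the partner's `BSD(E₁,3)`); NOT a class theorem.
[cite: GreenbergVatsal2000, Thm. (1.4) (arXiv:math/9906215 p. 5)] [cite: CastellaEtAl2021, Thm. 5.1.4 (proof)]
[cite: GreenbergLNM1716, Thm. 4.1 (p. 102)] -/
theorem RowC16.bsdp_three_rankZero_of_congruentPartner
    (hGV : thm14_mainConjecture_transfer_of_torsionIso) (hGr : greenberg_charValue_rankZero)
    (hmod : nonempty_modularParametrizationData)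
    (hGZK : rank_eq_analyticRank_of_analyticRank_le_one)
    (hW20 : lemma20_surjective_threeAdic_of_semistable) (hM : mazur_not_dvd_maninConstant_of_odd)
    (hK₁ : ∀ (κ : ZpExtension ℚ 3) (γ : Field.absoluteGaloisGroup ℚ) [NeZero (W₁.conductorNorm ℤ)]
      (f : CuspForm (Gamma0 (W₁.conductorNorm ℤ)) 2), kato_divisibility W₁ 3 (κ := κ) (γ := γ) (f := f))
    (hord₁ : GoodOrd W₁ 3) (hsurj₁ : Surj W₁ 3) (hL₁ : W₁.entireLFunction 1 ≠ 0) (hbsd₁ : BSDp W₁ 3)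
    (hμ₁ : ∀ [NeZero (W₁.conductorNorm ℤ)] (f₁ : CuspForm (Gamma0 (W₁.conductorNorm ℤ)) 2),
        IsNewformOf W₁ f₁ → ∀ (ϖ₁ : ℚ), (ϖ₁ : ℝ) * W₁.realPeriodRat = plusPeriod f₁ →
      ∃ n : ℕ, ‖PowerSeries.coeff n
        (PowerSeries.C (ϖ₁ : ℚ_[3]) * padicLFunction f₁ (unitRoot W₁ 3 : ℚ_[3]))‖ = 1)
    (hiso : ∃ e : geomTorsion W₁ ((3 : ℕ) : ℤ) ≃+ geomTorsion W₂ ((3 : ℕ) : ℤ),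
      ∀ (σ : Field.absoluteGaloisGroup ℚ) (P : geomTorsion W₁ ((3 : ℕ) : ℤ)), e (σ • P) = σ • e P)
    (h₂ : RowC16 W₂ 3) (hr0 : W₂.analyticRank = 0) : BSDp W₂ 3 :=
  RowC16.bsdp_rankZero_of_mazurMainConjecture hGr hmod hGZK h₂ hr0
    (mazurMainConjecture_three_of_congruentPartner W₁ W₂ hGV hGr hGZK hW20 hM hK₁ hord₁ hsurj₁ hL₁
      hbsd₁ hμ₁ hiso h₂.2.1)

/-- **Row C16 ∩ {r = 0} at `p = 3`: the L1 form** — the partner's `BSD(E₁,3)` itself from the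
PUBLISHED lever L1 (Wuthrich 2014 Prop. 21, `hW`: `ord_3 #Ш(E₁) ≤ ord_3 #Ш_an(E₁)`, with the lane's
exact `#Ш_an(E₁)` a `3`-adic unit, `hunit₁`; modularity `hmodL` to read `r_an(E₁) = 0`). So the
per-pair inputs are exactly: the partner `E₁` (rank `0`, good ordinary surjective `3`, `3 ∤ #Ш_an`),
C1 (`E₁[3] ≅ E₂[3]`) and C2 (one unit coefficient of `𝓛_MSD(E₁)`); every other input is a published
theorem BY NAME. [cite: Wuthrich2014, Prop. 21 (p. 400)] [cite: GreenbergVatsal2000, Thm. (1.4)]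
[cite: Kato2004Asterisque, Thm. 17.4 (3) (p. 273)] -/
theorem RowC16.bsdp_three_rankZero_of_congruentPartner_of_shaAn_unit
    (hGV : thm14_mainConjecture_transfer_of_torsionIso) (hGr : greenberg_charValue_rankZero)
    (hmod : nonempty_modularParametrizationData) (hmodL : hasEntireLFunction_rat)
    (hGZK : rank_eq_analyticRank_of_analyticRank_le_one) (hW : sha_dvd_analyticSha)
    (hW20 : lemma20_surjective_threeAdic_of_semistable) (hM : mazur_not_dvd_maninConstant_of_odd)
    (hK₁ : ∀ (κ : ZpExtension ℚ 3) (γ : Field.absoluteGaloisGroup ℚ) [NeZero (W₁.conductorNorm ℤ)]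
      (f : CuspForm (Gamma0 (W₁.conductorNorm ℤ)) 2), kato_divisibility W₁ 3 (κ := κ) (γ := γ) (f := f))
    (hord₁ : GoodOrd W₁ 3) (hsurj₁ : Surj W₁ 3) (hr0₁ : W₁.analyticRank = 0)
    (hunit₁ : ∃ q : ℚ, shaAn W₁ = (q : ℂ) ∧ padicValRat 3 q = 0)
    (hμ₁ : ∀ [NeZero (W₁.conductorNorm ℤ)] (f₁ : CuspForm (Gamma0 (W₁.conductorNorm ℤ)) 2),
        IsNewformOf W₁ f₁ → ∀ (ϖ₁ : ℚ), (ϖ₁ : ℝ) * W₁.realPeriodRat = plusPeriod f₁ →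
      ∃ n : ℕ, ‖PowerSeries.coeff n
        (PowerSeries.C (ϖ₁ : ℚ_[3]) * padicLFunction f₁ (unitRoot W₁ 3 : ℚ_[3]))‖ = 1)
    (hiso : ∃ e : geomTorsion W₁ ((3 : ℕ) : ℤ) ≃+ geomTorsion W₂ ((3 : ℕ) : ℤ),
      ∀ (σ : Field.absoluteGaloisGroup ℚ) (P : geomTorsion W₁ ((3 : ℕ) : ℤ)), e (σ • P) = σ • e P)
    (h₂ : RowC16 W₂ 3) (hr0 : W₂.analyticRank = 0) : BSDp W₂ 3 := by
  have hL₁ : W₁.entireLFunction 1 ≠ 0 := (W₁.analyticRank_eq_zero_iff_holds (hmodL W₁)).mp hr0₁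
  have hbsd₁ : BSDp W₁ 3 :=
    bsdp_of_L_one_ne_zero_of_padicValRat_shaAn_eq_zero hW hGZK W₁ 3 (by decide) hL₁
      (WeierstrassCurve.HasGoodReduction.not_hasAdditiveReduction _ hord₁.1) (Or.inr hsurj₁) hunit₁
  exact RowC16.bsdp_three_rankZero_of_congruentPartner W₁ W₂ hGV hGr hmod hGZK hW20 hM hK₁ hord₁ hsurj₁
    hL₁ hbsd₁ hμ₁ hiso h₂ hr0

/-- **Row C16 ∩ {r = 1} at `p = 3` WITHOUT Beilinson–Flach, MODULO the Schneider certificate**: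
`MazurMainConjecture W₂ 3` by congruence transfer from a rank-`0` partner (§2), then the cyclotomic
skeleton `RowC16.bsdp_rankOne_of_mazurMainConjecture_of_schneider` (Perrin-Riou–Schneider as printed by
Balakrishnan–Müller–Stein Thm. 1.7 at an odd prime `hS`, Perrin-Riou 1987 §1.4 `hPR`, Mazur–Tate σ
`hMT`, modularity, GZK, and the per-curve Schneider non-degeneracy certificate `hSch`). NOT the printed
rank-one route; recorded so that the census can price the rank-`1` half of row D3 on the same partner
data. [cite: GreenbergVatsal2000, Thm. (1.4)] [cite: PerrinRiou1987, §1.4 Cor. 1.8]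
[cite: BalakrishnanMullerStein2015, Thm. 1.7] -/
theorem RowC16.bsdp_three_rankOne_of_congruentPartner_of_schneider
    (hGV : thm14_mainConjecture_transfer_of_torsionIso) (hGr : greenberg_charValue_rankZero)
    (hS : Schneider1985_order_charGenerator_odd) (hPR : perrinRiou_rankOne_leadingTerms_odd)
    (hMT : mazur_tate_sigma_exists_odd) (hmod : nonempty_modularParametrizationData)
    (hGZK : rank_eq_analyticRank_of_analyticRank_le_one)
    (hW20 : lemma20_surjective_threeAdic_of_semistable) (hM : mazur_not_dvd_maninConstant_of_odd)
    (hK₁ : ∀ (κ : ZpExtension ℚ 3) (γ : Field.absoluteGaloisGroup ℚ) [NeZero (W₁.conductorNorm ℤ)]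
      (f : CuspForm (Gamma0 (W₁.conductorNorm ℤ)) 2), kato_divisibility W₁ 3 (κ := κ) (γ := γ) (f := f))
    (hord₁ : GoodOrd W₁ 3) (hsurj₁ : Surj W₁ 3) (hL₁ : W₁.entireLFunction 1 ≠ 0) (hbsd₁ : BSDp W₁ 3)
    (hμ₁ : ∀ [NeZero (W₁.conductorNorm ℤ)] (f₁ : CuspForm (Gamma0 (W₁.conductorNorm ℤ)) 2),
        IsNewformOf W₁ f₁ → ∀ (ϖ₁ : ℚ), (ϖ₁ : ℝ) * W₁.realPeriodRat = plusPeriod f₁ →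
      ∃ n : ℕ, ‖PowerSeries.coeff n
        (PowerSeries.C (ϖ₁ : ℚ_[3]) * padicLFunction f₁ (unitRoot W₁ 3 : ℚ_[3]))‖ = 1)
    (hiso : ∃ e : geomTorsion W₁ ((3 : ℕ) : ℤ) ≃+ geomTorsion W₂ ((3 : ℕ) : ℤ),
      ∀ (σ : Field.absoluteGaloisGroup ℚ) (P : geomTorsion W₁ ((3 : ℕ) : ℤ)), e (σ • P) = σ • e P)
    (h₂ : RowC16 W₂ 3) (hr1 : W₂.analyticRank = 1)
    (hSch : ∀ Dh : PAdicHeightData W₂ 3, Dh.IsCanonical → SchneiderConjecture Dh) : BSDp W₂ 3 :=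
  RowC16.bsdp_rankOne_of_mazurMainConjecture_of_schneider hS hPR hMT hmod hGZK h₂ hr1 hSch
    (mazurMainConjecture_three_of_congruentPartner W₁ W₂ hGV hGr hGZK hW20 hM hK₁ hord₁ hsurj₁ hL₁
      hbsd₁ hμ₁ hiso h₂.2.1)

end Partner

end Summit.BirchSwinnertonDyer.Rank1Residual

end
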